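import Literature.AnabelianGeometry.EtaleTheta.Discharge.Sec5DivTransportAssembly
import Literature.AnabelianGeometry.EtaleTheta.Discharge.Sec4RootDivisors
import HarnessLib

/-!
# [EtTh] Prop. 5.2 (i) / Prop. 4.2 (iii) read on divisors: the root-pair divisors DESCEND the divisor of `Θ̈` —
# GAP-LEDGER G-w5d245-2, LINK (b) («`div(Θ̈)` ↔ root-pair (NthRoot/FractionPair) dictionary in `Φ^gp`-currency»)

S. Mochizuki, *The étale theta function and its Frobenioid-theoretic manifestations*, Publ. RIMS **45** (2009):
Prop. 4.2 (iii) p.314 (PDF p.88) "commutative diagrams `A_N —s'_N→ B_N` over `A —s'→ B` via `α : A_N → A`, `β : B_N → B` — where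
`α, β` are isometries of Frobenius degree `N`"; Prop. 5.2 (i) p.324 (PDF p.98) "the pair of morphisms of `C` determined by `s_{l·N}`,
`τ_{l·N}` constitutes an `l·N`-th root of a right fraction-pair … of the theta function `Θ̈` …, or, alternatively, an `N`-th root of a
right fraction-pair of an `l`-th root of `Θ̈`"; Prop. 5.3 (vi) p.326 (PDF p.100) "the divisor of zeroes and poles `∈ Φ(A_⊚)^gp` of …
`Θ̈`"; [FrdI] Rem. 1.1.1 p.21 `Div(φ ∘ ψ) = Base(ψ)^* Div(φ) + deg_Fr(φ)·Div(ψ)` (tree: `PreFrobenioidData.div_comp`).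
[cite: MochizukiEtTh2009, Prop 4.2 (iii) p.314 (PDF p.88); Prop 5.2 (i) p.324 (PDF p.98); Prop 5.3 (vi) p.326 (PDF p.100)]
[cite: MochizukiFrdI2008, Rem. 1.1.1 p.21]

THE DICTIONARY.  For a square `ψ ≫ β = α ≫ φ` of a pre-Frobenioid with `α`, `β` ISOMETRIES, [FrdI] Rem. 1.1.1 gives at once
`Base(α)^* Div(φ) = deg_Fr(β) · Div(ψ)` (`PreFrobenioidData.pull_div_eq_div_pow_of_sq`).  Applied to the two squares of an `N`-th
root of a fraction-pair (`NthRoot.comm_num`, `NthRoot.comm_den`, `NthRoot.isIsometry`): the zero divisor and the divisor of poles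
of the fraction-pair PULL BACK along `α^bs` to the `deg_Fr(β)`-th multiples of those of the root pair; in `Φ^gp`:
`[Div s^⊓_N]^n = (α^bs)^*[Div t']`, `[Div s^⊔_N]^n = (α^bs)^*[Div t'']` with `n = deg_Fr(β)` — LITERALLY the binder `hdesc` of
abc-iut-w5-d245's assembly `ThetaFrobenioid.exists_aut_div_transport_eq_of_links` (`Sec5DivTransportAssembly.lean`), with
`Z₀ := [Div t']`, `W₀ := [Div t'']`, `φ := α`; hence `(α^bs)^*(div Θ̈) = ([Div s^⊓_N]·[Div s^⊔_N]⁻¹)^n` whenever the stub datum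
`𝔓.divTheta` ([EtTh] §5 `DivisorPrimeData`) IS `[Div t']·[Div t'']⁻¹` for a fraction-pair `(t', t'')` of `Θ̈` over the root pair.
At the GENUINE §5 data `ThetaFrobenioid.ofConnectedTemperoidData …` over `B^temp(Π^tp_X)⁰` (abc-iut-L2-t4: `A_⊚ = A_⊙`,
`s^⊓_N, s^⊔_N := R.pair.num, R.pair.den` for an `N`-th root `R` of the `l`-th root `Rl` of `Θ̈ = θ` with fraction-pair `Pl`) the
two stacked squares give `((α_N ≫ α_l)^bs)^* Div(Pl.num) = (N·l) · Div(s^⊓_N)` (and `den`), i.e. `hdesc` with `n = N·l`,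
`φ = α_N ≫ α_l`, `Z₀ = [Div Pl.num]`, `W₀ = [Div Pl.den]` and NO residual hypothesis; and the assembly's conclusion with `hdesc`
DISCHARGED (`exists_aut_div_transport_eq_of_links_of_sq`).

abc-iut cell, layer L2, ROWS #29 **R378** (abc-iut-L2-lead gen 4): GAP G-w5d245-2 LINK (b), seat abc-iut-w6-d043 (gen 3).
PROOF-ONLY (0 definitions, no new named fact; `𝔓.divTheta` stays the free stub datum — the dictionary is an identity for the
root-pair divisors plus its reading under `hΘ : 𝔓.divTheta = [Div t']·[Div t'']⁻¹`).  Links (a) [FrdI] Thm. 4.9 (abc-iut-w6-d052),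
(c) zero/pole split (this seat, `Sec5Prop53ZeroPoleSplit.lean`), (d) orbit lift (abc-iut-f-123) and the assembly (abc-iut-w5-d245)
are consumed BY NAME only.  HONEST FRAMING: kernel-checked [FrdI] Rem. 1.1.1 bookkeeping over the typed §4/§5 structures;
nothing here asserts a result of [EtTh] for an actual curve; typed ≠ proved; no side taken on [IUTchIII] Cor. 3.12.
-/

open CategoryTheory Opposite

/-! ## §1. [FrdI] Rem. 1.1.1: a square of pre-Frobenioid arrows with isometric sides -/

namespace Literature.AlgebraicGeometry.Frobenioids.PreFrobenioidData

universe w v v' u u'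

variable {C : Type u} [Category.{v} C] {D : Type u'} [Category.{v'} D] (S : PreFrobenioidData.{w} C D)

/-- Post-composition with an ISOMETRY `β` multiplies the zero divisor by `deg_Fr(β)`: `Div(β ∘ ψ) = deg_Fr(β) · Div(ψ)`
([FrdI] Rem. 1.1.1 with `Div(β) = 0`). [cite: MochizukiFrdI2008, Rem. 1.1.1 p.21] -/
theorem div_comp_of_isIsometry_right {A B B' : C} (ψ : A ⟶ B) {β : B ⟶ B'} (hβ : S.IsIsometry β) :
    S.div (ψ ≫ β) = S.div ψ ^ (S.degFr β : ℕ) := by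
  have hβ' : S.div β = 1 := hβ
  rw [S.div_comp, hβ', map_one, one_mul]

/-- Pre-composition with an ISOMETRY `α` pulls the zero divisor back: `Div(φ ∘ α) = Base(α)^* Div(φ)` ([FrdI] Rem. 1.1.1 with
`Div(α) = 0`). [cite: MochizukiFrdI2008, Rem. 1.1.1 p.21] -/
theorem div_comp_of_isIsometry_left {A A' B' : C} {α : A ⟶ A'} (hα : S.IsIsometry α) (φ : A' ⟶ B') :
    S.div (α ≫ φ) = S.pull (S.base.map α) (S.div φ) := by
  have hα' : S.div α = 1 := hα
  rw [S.div_comp, hα', one_pow, mul_one]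

/-- Isometries compose ([FrdI] Rem. 1.1.1). [cite: MochizukiFrdI2008, Rem. 1.1.1 p.21] -/
theorem isIsometry_comp {A A' A'' : C} {α : A ⟶ A'} {α' : A' ⟶ A''} (hα : S.IsIsometry α) (hα' : S.IsIsometry α') :
    S.IsIsometry (α ≫ α') := by
  have h1 : S.div α' = 1 := hα'
  show S.div (α ≫ α') = 1
  rw [S.div_comp_of_isIsometry_left hα, h1, map_one]

/-- **The square lemma** ([FrdI] Rem. 1.1.1; the divisor content of [EtTh] Prop. 4.2 (iii)): for a commutative square
`ψ ≫ β = α ≫ φ` whose sides `α`, `β` are ISOMETRIES, `Base(α)^* Div(φ) = deg_Fr(β) · Div(ψ)`.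
[cite: MochizukiFrdI2008, Rem. 1.1.1 p.21] [cite: MochizukiEtTh2009, Prop 4.2 (iii) p.314 (PDF p.88)] -/
theorem pull_div_eq_div_pow_of_sq {A B A' B' : C} {ψ : A ⟶ B} {β : B ⟶ B'} {α : A ⟶ A'} {φ : A' ⟶ B'}
    (hsq : ψ ≫ β = α ≫ φ) (hα : S.IsIsometry α) (hβ : S.IsIsometry β) :
    S.pull (S.base.map α) (S.div φ) = S.div ψ ^ (S.degFr β : ℕ) := by
  rw [← S.div_comp_of_isIsometry_left hα φ, ← hsq, S.div_comp_of_isIsometry_right ψ hβ]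

/-- The square lemma in `Φ^gp` ([FrdI] §0 `M ↦ M^gp`): `(Base(α)^*)^gp [Div φ] = [Div ψ]^{deg_Fr(β)}`.
[cite: MochizukiFrdI2008, Rem. 1.1.1 p.21] -/
theorem gpMap_pull_of_div_eq_of_sq {A B A' B' : C} {ψ : A ⟶ B} {β : B ⟶ B'} {α : A ⟶ A'} {φ : A' ⟶ B'}
    (hsq : ψ ≫ β = α ≫ φ) (hα : S.IsIsometry α) (hβ : S.IsIsometry β) :
    gpMap (S.pull (S.base.map α)) (Algebra.GrothendieckGroup.of (S.div φ)) =
      Algebra.GrothendieckGroup.of (S.div ψ) ^ (S.degFr β : ℕ) := by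
  rw [gpMap_of, S.pull_div_eq_div_pow_of_sq hsq hα hβ, map_pow]

end Literature.AlgebraicGeometry.Frobenioids.PreFrobenioidData

/-! ## §2. LINK (b) over any §5 data `𝔉 : ThetaFrobenioid` — the assembly's binder `hdesc` from the root squares -/

namespace Literature.AnabelianGeometry.EtaleTheta

open Literature.AlgebraicGeometry.Frobenioids

namespace ThetaFrobenioid

section Generic

universe w v v' u u'

variable {C : Type u} [Category.{v} C] {D : Type u'} [Category.{v'} D] (𝔉 : ThetaFrobenioid.{w} C D)

/-- **LINK (b), monoid level** ([EtTh] Prop. 4.2 (iii) / 5.2 (i) on divisors): if the root pair `s^⊓_N, s^⊔_N : A_N → B_N` sits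
in commutative squares over a pair `t', t'' : A_⊚ → B'` via ISOMETRIES `φ : A_N → A_⊚`, `β : B_N → B'` with `deg_Fr(β) = n`, then
`(φ^bs)^* Div(t') = n · Div(s^⊓_N)` and `(φ^bs)^* Div(t'') = n · Div(s^⊔_N)`.
[cite: MochizukiEtTh2009, Prop 4.2 (iii) p.314 (PDF p.88); Prop 5.2 (i) p.324 (PDF p.98)] -/
theorem pull_div_pair_eq_div_rootPair_pow {B' : C} {t' t'' : 𝔉.Acirc ⟶ B'} {φ : 𝔉.AN ⟶ 𝔉.Acirc} {β : 𝔉.BN ⟶ B'}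
    (hsq' : 𝔉.sCap ≫ β = φ ≫ t') (hsq'' : 𝔉.sCup ≫ β = φ ≫ t'') (hφ : 𝔉.IsIsometry φ) (hβ : 𝔉.IsIsometry β)
    {n : ℕ} (hn : (𝔉.degFr β : ℕ) = n) :
    𝔉.pre.pull (𝔉.base.map φ) (𝔉.pre.div t') = 𝔉.pre.div 𝔉.sCap ^ n ∧
      𝔉.pre.pull (𝔉.base.map φ) (𝔉.pre.div t'') = 𝔉.pre.div 𝔉.sCup ^ n := by
  subst hn
  exact ⟨𝔉.pre.pull_div_eq_div_pow_of_sq hsq' hφ hβ, 𝔉.pre.pull_div_eq_div_pow_of_sq hsq'' hφ hβ⟩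

/-- **LINK (b) in `Φ^gp`, LITERALLY the binder `hdesc` of the assembly `exists_aut_div_transport_eq_of_links`** (with
`Z₀ := [Div t']`, `W₀ := [Div t'']`, `n := deg_Fr(β)`): `[Div s^⊓_N]^n = (φ^bs)^{*gp} [Div t']` and
`[Div s^⊔_N]^n = (φ^bs)^{*gp} [Div t'']`.  [cite: MochizukiEtTh2009, Prop 5.2 (i) p.324 (PDF p.98); Prop 5.3 (vi) p.326 (PDF p.100)] -/
theorem rootPair_hdesc_of_sq {B' : C} {t' t'' : 𝔉.Acirc ⟶ B'} {φ : 𝔉.AN ⟶ 𝔉.Acirc} {β : 𝔉.BN ⟶ B'}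
    (hsq' : 𝔉.sCap ≫ β = φ ≫ t') (hsq'' : 𝔉.sCup ≫ β = φ ≫ t'') (hφ : 𝔉.IsIsometry φ) (hβ : 𝔉.IsIsometry β)
    {n : ℕ} (hn : (𝔉.degFr β : ℕ) = n) :
    Algebra.GrothendieckGroup.of (𝔉.pre.div 𝔉.sCap) ^ n =
        AlgebraicGeometry.Frobenioids.gpMap (𝔉.pre.pull (𝔉.base.map φ)) (Algebra.GrothendieckGroup.of (𝔉.pre.div t')) ∧
      Algebra.GrothendieckGroup.of (𝔉.pre.div 𝔉.sCup) ^ n =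
        AlgebraicGeometry.Frobenioids.gpMap (𝔉.pre.pull (𝔉.base.map φ)) (Algebra.GrothendieckGroup.of (𝔉.pre.div t'')) := by
  subst hn
  exact ⟨(𝔉.pre.gpMap_pull_of_div_eq_of_sq hsq' hφ hβ).symm, (𝔉.pre.gpMap_pull_of_div_eq_of_sq hsq'' hφ hβ).symm⟩

/-- **LINK (b) read on the stub datum**: if `𝔓.divTheta` ("the divisor of zeroes and poles `∈ Φ(A_⊚)^gp` of `Θ̈`", Prop. 5.3 (vi))
IS `[Div t']·[Div t'']⁻¹` for such a pair, then `(φ^bs)^{*gp}(div Θ̈) = ([Div s^⊓_N]·[Div s^⊔_N]⁻¹)^n`, `n = deg_Fr(β)`.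
[cite: MochizukiEtTh2009, Prop 5.3 (vi) p.326 (PDF p.100); Prop 5.2 (i) p.324 (PDF p.98)] -/
theorem gpMap_pull_divTheta_eq_of_sq (𝔓 : FrobenioidThetaDivisors.DivisorPrimeData 𝔉) {B' : C} {t' t'' : 𝔉.Acirc ⟶ B'}
    {φ : 𝔉.AN ⟶ 𝔉.Acirc} {β : 𝔉.BN ⟶ B'} (hsq' : 𝔉.sCap ≫ β = φ ≫ t') (hsq'' : 𝔉.sCup ≫ β = φ ≫ t'')
    (hφ : 𝔉.IsIsometry φ) (hβ : 𝔉.IsIsometry β) {n : ℕ} (hn : (𝔉.degFr β : ℕ) = n)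
    (hΘ : 𝔓.divTheta = Algebra.GrothendieckGroup.of (𝔉.pre.div t') / Algebra.GrothendieckGroup.of (𝔉.pre.div t'')) :
    AlgebraicGeometry.Frobenioids.gpMap (𝔉.pre.pull (𝔉.base.map φ)) 𝔓.divTheta =
      (Algebra.GrothendieckGroup.of (𝔉.pre.div 𝔉.sCap) / Algebra.GrothendieckGroup.of (𝔉.pre.div 𝔉.sCup)) ^ n := by
  obtain ⟨h1, h2⟩ := 𝔉.rootPair_hdesc_of_sq hsq' hsq'' hφ hβ hn
  rw [hΘ, map_div, ← h1, ← h2, div_pow]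

/-- **G-w5d245-2 with LINK (b) DISCHARGED** (abc-iut-w5-d245's `exists_aut_div_transport_eq_of_links`, its binder `hdesc` supplied
by `rootPair_hdesc_of_sq`): from "isomorphisms are isometries", `s^trv_N`, the transitive torsor law of `A_N^bs`, LINK (a)
(`induced` at `ofThm49`), the split form of Prop. 5.3 (vi)+(i) for `Z₀ = [Div t']`, `W₀ = [Div t'']`, the root SQUARES over
`(t', t'')` with isometric sides (`deg_Fr(β) = n`), and the cancellation laws of `Φ(A_N)` — ONE `ε ∈ Aut_C(A_N)` with
`Div(α⁻¹ ≫ Ψ s^⊓_N) = Div(ε ≫ s^⊓_N)`, `Div(α⁻¹ ≫ Ψ s^⊔_N) = Div(ε ≫ s^⊔_N)`.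
[cite: MochizukiEtTh2009, Thm 5.6 proof p.329 (PDF p.103); Prop 5.3 (vi) p.326 (PDF p.100)] -/
theorem exists_aut_div_transport_eq_of_links_of_sq (hiso : ∀ ⦃X Y : C⦄ (c : X ≅ Y), 𝔉.pre.div c.hom = 1)
    (hstrv : 𝔉.StrvSection)
    (hGal : ∀ a b : 𝔉.base.obj 𝔉.AN ⟶ 𝔉.base.obj 𝔉.Acirc, ∃ σ : Aut (𝔉.base.obj 𝔉.AN), σ.hom ≫ a = b)
    {Ψ : C ≌ C} (ι : Ψ.functor.obj 𝔉.Acirc ≅ 𝔉.Acirc) (α : Ψ.functor.obj 𝔉.AN ≅ 𝔉.AN)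
    {B' : C} {t' t'' : 𝔉.Acirc ⟶ B'} {φ : 𝔉.AN ⟶ 𝔉.Acirc} {β : 𝔉.BN ⟶ B'}
    (hsq' : 𝔉.sCap ≫ β = φ ≫ t') (hsq'' : 𝔉.sCup ≫ β = φ ≫ t'') (hφ : 𝔉.IsIsometry φ) (hβ : 𝔉.IsIsometry β)
    {n : ℕ} (hn : (𝔉.degFr β : ℕ) = n)
    {eΦ : 𝔉.PhiAcirc ≃* 𝔉.pre.Mon (𝔉.base.obj (Ψ.functor.obj 𝔉.Acirc))}
    (induced : (FrobenioidThetaDivisors.DivisorTransportStub.ofThm49 𝔉).IsInducedBy Ψ 𝔉.Acirc eΦ)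
    (hsplit : ∃ g : Aut 𝔉.Acirc,
      ThetaFrobenioid.gpMap (FrobenioidThetaDivisors.psiPhi 𝔉 Ψ ι eΦ : 𝔉.PhiAcirc →* 𝔉.PhiAcirc)
          (Algebra.GrothendieckGroup.of (𝔉.pre.div t')) =
        ThetaFrobenioid.gpMap (𝔉.pullAut g : 𝔉.PhiAcirc →* 𝔉.PhiAcirc) (Algebra.GrothendieckGroup.of (𝔉.pre.div t')) ∧
      ThetaFrobenioid.gpMap (FrobenioidThetaDivisors.psiPhi 𝔉 Ψ ι eΦ : 𝔉.PhiAcirc →* 𝔉.PhiAcirc)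
          (Algebra.GrothendieckGroup.of (𝔉.pre.div t'')) =
        ThetaFrobenioid.gpMap (𝔉.pullAut g : 𝔉.PhiAcirc →* 𝔉.PhiAcirc) (Algebra.GrothendieckGroup.of (𝔉.pre.div t'')))
    (htf : ∀ x y : Algebra.GrothendieckGroup (𝔉.pre.Mon (𝔉.base.obj 𝔉.AN)), x ^ n = y ^ n → x = y)
    (hof : Function.Injective
      (Algebra.GrothendieckGroup.of : 𝔉.pre.Mon (𝔉.base.obj 𝔉.AN) → Algebra.GrothendieckGroup (𝔉.pre.Mon (𝔉.base.obj 𝔉.AN)))) :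
    ∃ ε : Aut 𝔉.AN,
      𝔉.pre.div (α.inv ≫ Ψ.functor.map 𝔉.sCap) = 𝔉.pre.div (ε.hom ≫ 𝔉.sCap) ∧
      𝔉.pre.div (α.inv ≫ Ψ.functor.map 𝔉.sCup) = 𝔉.pre.div (ε.hom ≫ 𝔉.sCup) :=
  𝔉.exists_aut_div_transport_eq_of_links hiso hstrv hGal ι α φ induced _ _ hsplit
    (𝔉.rootPair_hdesc_of_sq hsq' hsq'' hφ hβ hn) htf hof

end Generic

/-! ## §3. At the GENUINE §5 data over `B^temp(Π^tp_X)⁰`: the two stacked root squares, NO residual hypothesis -/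

section ConnectedTemperoidData

open Literature.AnabelianGeometry.SemiGraphs

universe u₀ v₀ w₀

variable {K : Type u₀} [Field K] {X : SemiGraphs.TemperedArithmeticGroup.{u₀} K} {D₀ : Type u₀} [Category.{v₀} D₀]
  {V : FrdIMonoidStub.{w₀}} {T₀ : RealifiedDivisorMonoids (D₀ := D₀) V}
  {VD : FrdICatStub.{u₀ + 1, u₀, w₀} (ConnectedPart (BTemp X.Pi))}
  {tf : TemperedFrobenioid T₀ (ConnectedPart (BTemp X.Pi)) VD} {hZ : tf.monoidType = MonoidType.Z}
  {hP : ∀ A : (ConnectedPart (BTemp X.Pi))ᵒᵖ, IsPerfect (tf.Φ.carrier A)}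
  {NH : Subgroup (Field.absoluteGaloisGroup K) → tf.category → ℕ+ → Prop} {A₀ : tf.category}
  {hA₀ : PreFrobenioid.IsFrobeniusTrivial tf.toElem A₀} {hA₀' : SemiGraphs.IsGaloisObj A₀.base.obj}
  {lv N : ℕ+} {T : ThetaEnvData.{max u₀ w₀} N}
  {pullFrac : ∀ {A A' : (BiKummerSetting.mkOfConnectedTemperoid X tf hZ hP NH A₀ hA₀ hA₀').C} (_ : A' ⟶ A),
    (BiKummerSetting.mkOfConnectedTemperoid X tf hZ hP NH A₀ hA₀ hA₀').biratUnits A →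
      (BiKummerSetting.mkOfConnectedTemperoid X tf hZ hP NH A₀ hA₀ hA₀').biratUnits A'}
  {θ : (BiKummerSetting.mkOfConnectedTemperoid X tf hZ hP NH A₀ hA₀ hA₀').biratUnits
    (BiKummerSetting.mkOfConnectedTemperoid X tf hZ hP NH A₀ hA₀ hA₀').Aodot}
  {Bl : (BiKummerSetting.mkOfConnectedTemperoid X tf hZ hP NH A₀ hA₀ hA₀').C}
  {Pl : (BiKummerSetting.mkOfConnectedTemperoid X tf hZ hP NH A₀ hA₀ hA₀').FractionPair θ Bl}
  {Rl : (BiKummerSetting.mkOfConnectedTemperoid X tf hZ hP NH A₀ hA₀ hA₀').NthRoot θ Pl lv pullFrac}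
  (h : ModelFrobenioid.Hypotheses tf.divisorMonoid tf.ratFnFunctor)
  (Q : FrobenioidTheta.ThetaSubquotientStub.{w₀} (ConnectedPart (BTemp X.Pi))) (odd_l : Odd (lv : ℕ))
  (R : (BiKummerSetting.mkOfConnectedTemperoid X tf hZ hP NH A₀ hA₀ hA₀').NthRoot Rl.root Rl.pair N pullFrac)
  (ιX : T.PiX ≃ₜ* X.Pi) (K' : Type w₀) [Field K'] (constEmb : K'ˣ →* tf.biratUnitsModel R.BN)
  (constEmb_injective : Function.Injective constEmb)
  (hinvc : ∀ g : Aut R.AN.base,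
    pull tf.divisorMonoid g.hom (ModelFrobenioid.div R.pair.num) = ModelFrobenioid.div R.pair.num)
  (hinvp : ∀ y : T.PiX, y ∈ T.PiYdd →
    pull tf.divisorMonoid ((BiKummerSetting.mkOfConnectedTemperoid X tf hZ hP NH A₀ hA₀ hA₀').galoisSurj R.AN.base
      R.αData.isGalois (ιX y)).hom (ModelFrobenioid.div R.pair.den) = ModelFrobenioid.div R.pair.den)

/-- **The two stacked root squares at the genuine data and the isometry of their sides** (Prop. 5.2 (i): "an `l·N`-th root of a
right fraction-pair of `Θ̈` …, or, alternatively, an `N`-th root of a right fraction-pair of an `l`-th root of `Θ̈`"; Prop. 4.2 (iii)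
squares `NthRoot.comm_num` / `comm_den` of `R` over `Rl` and of `Rl` over `Pl`): `s^⊓_N ≫ (β_N ≫ β_l) = (α_N ≫ α_l) ≫ Pl.num`,
`s^⊔_N ≫ (β_N ≫ β_l) = (α_N ≫ α_l) ≫ Pl.den`, and `α_N ≫ α_l`, `β_N ≫ β_l` are isometries.
[cite: MochizukiEtTh2009, Prop 5.2 (i) p.324 (PDF p.98); Prop 4.2 (iii) p.314 (PDF p.88)] -/
theorem rootTower_sq_isIsometry :
    R.pair.num ≫ (R.β ≫ Rl.β) = (R.α ≫ Rl.α) ≫ Pl.num ∧ R.pair.den ≫ (R.β ≫ Rl.β) = (R.α ≫ Rl.α) ≫ Pl.den ∧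
      (ofConnectedTemperoidData h Q odd_l R ιX K' constEmb constEmb_injective hinvc hinvp).IsIsometry (R.α ≫ Rl.α) ∧
      (ofConnectedTemperoidData h Q odd_l R ιX K' constEmb constEmb_injective hinvc hinvp).IsIsometry (R.β ≫ Rl.β) := by
  refine ⟨?_, ?_, ?_, ?_⟩
  · rw [← Category.assoc, R.comm_num, Category.assoc, Rl.comm_num, Category.assoc]
  · rw [← Category.assoc, R.comm_den, Category.assoc, Rl.comm_den, Category.assoc]
  · exact (ofConnectedTemperoidData h Q odd_l R ιX K' constEmb constEmb_injective hinvc hinvp).pre.isIsometry_comp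
      R.isIsometry.1 Rl.isIsometry.1
  · exact (ofConnectedTemperoidData h Q odd_l R ιX K' constEmb constEmb_injective hinvc hinvp).pre.isIsometry_comp
      R.isIsometry.2.1 Rl.isIsometry.2.1

/-- The Frobenius degree of the stacked side `β_N ≫ β_l` is `N·l` (`NthRoot.isIsometry`: `deg_Fr(β_N) = N`, `deg_Fr(β_l) = l`;
[FrdI] Rem. 1.1.1: `deg_Fr` is multiplicative).  [cite: MochizukiEtTh2009, Prop 4.2 (iii) p.314 (PDF p.88)] [cite: MochizukiFrdI2008, Rem. 1.1.1 p.21] -/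
theorem degFr_rootTower_eq :
    ((ofConnectedTemperoidData h Q odd_l R ιX K' constEmb constEmb_injective hinvc hinvp).degFr (R.β ≫ Rl.β) : ℕ) = (N : ℕ) * (lv : ℕ) := by
  have hN : (ofConnectedTemperoidData h Q odd_l R ιX K' constEmb constEmb_injective hinvc hinvp).pre.degFr R.β = N :=
    R.isIsometry.2.2.2
  have hl : (ofConnectedTemperoidData h Q odd_l R ιX K' constEmb constEmb_injective hinvc hinvp).pre.degFr Rl.β = lv :=
    Rl.isIsometry.2.2.2
  show (((ofConnectedTemperoidData h Q odd_l R ιX K' constEmb constEmb_injective hinvc hinvp).pre.degFr (R.β ≫ Rl.β) : ℕ+) : ℕ) = _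
  rw [(ofConnectedTemperoidData h Q odd_l R ιX K' constEmb constEmb_injective hinvc hinvp).pre.degFr_comp, PNat.mul_coe, hN, hl]

/-- **LINK (b) at the genuine §5 data, in the ASSEMBLY's literal currency, NO residual hypothesis** (`𝔉 := ofConnectedTemperoidData …`,
whose `s^⊓_N, s^⊔_N, A_⊚` are `R.pair.num, R.pair.den, A_⊙` and whose `(Base, Div, deg_Fr, pull)` are the model's, all by `rfl`):
the binder `hdesc` of `exists_aut_div_transport_eq_of_links` HOLDS with `n := N·l`, `φ := α_N ≫ α_l`, `Z₀ := [Div Pl.num]`,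
`W₀ := [Div Pl.den]`: `[Div s^⊓_N]^{N·l} = ((α_N ≫ α_l)^bs)^{*gp} [Div Pl.num]`, `[Div s^⊔_N]^{N·l} = ((α_N ≫ α_l)^bs)^{*gp} [Div Pl.den]`.
[cite: MochizukiEtTh2009, Prop 5.2 (i) p.324 (PDF p.98); Prop 5.3 (vi) p.326 (PDF p.100)] -/
theorem rootPair_hdesc_ofConnectedTemperoidData :
    Algebra.GrothendieckGroup.of
          ((ofConnectedTemperoidData h Q odd_l R ιX K' constEmb constEmb_injective hinvc hinvp).pre.div
            (ofConnectedTemperoidData h Q odd_l R ιX K' constEmb constEmb_injective hinvc hinvp).sCap) ^ ((N : ℕ) * (lv : ℕ)) =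
        AlgebraicGeometry.Frobenioids.gpMap
          ((ofConnectedTemperoidData h Q odd_l R ιX K' constEmb constEmb_injective hinvc hinvp).pre.pull
            ((ofConnectedTemperoidData h Q odd_l R ιX K' constEmb constEmb_injective hinvc hinvp).base.map (R.α ≫ Rl.α)))
          (Algebra.GrothendieckGroup.of
            ((ofConnectedTemperoidData h Q odd_l R ιX K' constEmb constEmb_injective hinvc hinvp).pre.div Pl.num)) ∧
      Algebra.GrothendieckGroup.of
          ((ofConnectedTemperoidData h Q odd_l R ιX K' constEmb constEmb_injective hinvc hinvp).pre.div
            (ofConnectedTemperoidData h Q odd_l R ιX K' constEmb constEmb_injective hinvc hinvp).sCup) ^ ((N : ℕ) * (lv : ℕ)) =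
        AlgebraicGeometry.Frobenioids.gpMap
          ((ofConnectedTemperoidData h Q odd_l R ιX K' constEmb constEmb_injective hinvc hinvp).pre.pull
            ((ofConnectedTemperoidData h Q odd_l R ιX K' constEmb constEmb_injective hinvc hinvp).base.map (R.α ≫ Rl.α)))
          (Algebra.GrothendieckGroup.of
            ((ofConnectedTemperoidData h Q odd_l R ιX K' constEmb constEmb_injective hinvc hinvp).pre.div Pl.den)) := by
  obtain ⟨hsq', hsq'', hφ, hβ⟩ := rootTower_sq_isIsometry h Q odd_l R ιX K' constEmb constEmb_injective hinvc hinvp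
  exact (ofConnectedTemperoidData h Q odd_l R ιX K' constEmb constEmb_injective hinvc hinvp).rootPair_hdesc_of_sq hsq' hsq'' hφ hβ
    (degFr_rootTower_eq h Q odd_l R ιX K' constEmb constEmb_injective hinvc hinvp)

/-- **LINK (b) read on the stub datum at the genuine data** (assembly currency): for ANY §5 divisor-prime stub `𝔓` over
`ofConnectedTemperoidData …` whose `divTheta` IS `[Div Pl.num]·[Div Pl.den]⁻¹` (the divisor of zeroes and poles of `Θ̈ = θ` through
its fraction-pair `Pl`), `((α_N ≫ α_l)^bs)^{*gp}(div Θ̈) = ([Div s^⊓_N]·[Div s^⊔_N]⁻¹)^{N·l}`.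
[cite: MochizukiEtTh2009, Prop 5.3 (vi) p.326 (PDF p.100); Prop 5.2 (i) p.324 (PDF p.98)] -/
theorem gpMap_pull_divTheta_ofConnectedTemperoidData
    (𝔓 : FrobenioidThetaDivisors.DivisorPrimeData
      (ofConnectedTemperoidData h Q odd_l R ιX K' constEmb constEmb_injective hinvc hinvp))
    (hΘ : 𝔓.divTheta =
      Algebra.GrothendieckGroup.of
          ((ofConnectedTemperoidData h Q odd_l R ιX K' constEmb constEmb_injective hinvc hinvp).pre.div Pl.num) /
        Algebra.GrothendieckGroup.of
          ((ofConnectedTemperoidData h Q odd_l R ιX K' constEmb constEmb_injective hinvc hinvp).pre.div Pl.den)) :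
    AlgebraicGeometry.Frobenioids.gpMap
        ((ofConnectedTemperoidData h Q odd_l R ιX K' constEmb constEmb_injective hinvc hinvp).pre.pull
          ((ofConnectedTemperoidData h Q odd_l R ιX K' constEmb constEmb_injective hinvc hinvp).base.map (R.α ≫ Rl.α))) 𝔓.divTheta =
      (Algebra.GrothendieckGroup.of
            ((ofConnectedTemperoidData h Q odd_l R ιX K' constEmb constEmb_injective hinvc hinvp).pre.div
              (ofConnectedTemperoidData h Q odd_l R ιX K' constEmb constEmb_injective hinvc hinvp).sCap) /
          Algebra.GrothendieckGroup.of
            ((ofConnectedTemperoidData h Q odd_l R ιX K' constEmb constEmb_injective hinvc hinvp).pre.div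
              (ofConnectedTemperoidData h Q odd_l R ιX K' constEmb constEmb_injective hinvc hinvp).sCup)) ^ ((N : ℕ) * (lv : ℕ)) := by
  obtain ⟨hsq', hsq'', hφ, hβ⟩ := rootTower_sq_isIsometry h Q odd_l R ιX K' constEmb constEmb_injective hinvc hinvp
  exact (ofConnectedTemperoidData h Q odd_l R ιX K' constEmb constEmb_injective hinvc hinvp).gpMap_pull_divTheta_eq_of_sq 𝔓 hsq' hsq'' hφ hβ
    (degFr_rootTower_eq h Q odd_l R ιX K' constEmb constEmb_injective hinvc hinvp) hΘ

/-- The same in the tf-currency of abc-iut-f-123's LINK (d) (`pullGp tf.divisorMonoid`, `ModelFrobenioid.div`; definitionally equal).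
[cite: MochizukiEtTh2009, Prop 5.3 (vi) p.326 (PDF p.100)] -/
theorem pullGp_divTheta_eq_rootPair_pow_ofConnectedTemperoidData
    (𝔓 : FrobenioidThetaDivisors.DivisorPrimeData
      (ofConnectedTemperoidData h Q odd_l R ιX K' constEmb constEmb_injective hinvc hinvp))
    (hΘ : 𝔓.divTheta = Algebra.GrothendieckGroup.of (ModelFrobenioid.div Pl.num) /
      Algebra.GrothendieckGroup.of (ModelFrobenioid.div Pl.den)) :
    pullGp tf.divisorMonoid (ModelFrobenioid.baseMap (R.α ≫ Rl.α)) 𝔓.divTheta =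
      (Algebra.GrothendieckGroup.of (ModelFrobenioid.div R.pair.num) /
        Algebra.GrothendieckGroup.of (ModelFrobenioid.div R.pair.den)) ^ ((N : ℕ) * (lv : ℕ)) :=
  gpMap_pull_divTheta_ofConnectedTemperoidData h Q odd_l R ιX K' constEmb constEmb_injective hinvc hinvp 𝔓 hΘ

end ConnectedTemperoidData

end ThetaFrobenioid

/-! ## §4. The same tower over ANY bi-Kummer setting `S` (model currency, [FrdI] Thm. 5.2): no §5 superstructure needed -/

namespace BiKummerSetting.NthRoot

universe u₀ v₀ u v w

variable {K : Type u₀} [Field K] {X : SemiGraphs.TemperedArithmeticGroup.{u₀} K} {D₀ : Type u₀} [Category.{v₀} D₀]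
  {V : FrdIMonoidStub.{w}} {T : RealifiedDivisorMonoids (D₀ := D₀) V} {D : Type u} [Category.{v} D]
  {VD : FrdICatStub.{u, v, w} D} {S : BiKummerSetting X T D VD}
  {A B : S.C} {f : S.biratUnits A} {P : S.FractionPair f B} {lv N : ℕ+}
  {pullFrac : ∀ {A A' : S.C} (_ : A' ⟶ A), S.biratUnits A → S.biratUnits A'}
  {Rl : S.NthRoot f P lv pullFrac} (R : S.NthRoot Rl.root Rl.pair N pullFrac)

/-- **The stacked tower, monoid level** (Prop. 5.2 (i) read on divisors): for an `N`-th root `R` of an `l`-th root `Rl` of a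
fraction-pair `P` of `f` on `A`, `((α_N ≫ α_l)^bs)^* Div(P.num) = (N·l) · Div(s^⊓_N)` and `((α_N ≫ α_l)^bs)^* Div(P.den) =
(N·l) · Div(s^⊔_N)`; the one-level identities are abc-iut-L6-t12's `BiKummerSetting.NthRoot.div_num_pow` / `div_den_pow`
(`Sec4RootDivisors.lean`, proof of Prop. 4.3 (i)), consumed BY NAME.
[cite: MochizukiEtTh2009, Prop 5.2 (i) p.324 (PDF p.98); Prop 4.3 (i) p.317 (PDF p.91)] -/
theorem pull_div_pair_eq_div_pow_tower :
    pull S.tf.divisorMonoid (ModelFrobenioid.baseMap (R.α ≫ Rl.α)) (ModelFrobenioid.div P.num) =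
        ModelFrobenioid.div R.pair.num ^ ((N : ℕ) * (lv : ℕ)) ∧
      pull S.tf.divisorMonoid (ModelFrobenioid.baseMap (R.α ≫ Rl.α)) (ModelFrobenioid.div P.den) =
        ModelFrobenioid.div R.pair.den ^ ((N : ℕ) * (lv : ℕ)) := by
  refine ⟨?_, ?_⟩
  · exact (pull_comp S.tf.divisorMonoid (ModelFrobenioid.baseMap R.α) (ModelFrobenioid.baseMap Rl.α) _).trans
      (((congrArg (pull S.tf.divisorMonoid (ModelFrobenioid.baseMap R.α)) Rl.div_num_pow.symm).trans
        (map_pow _ _ _)).trans (((congrArg (· ^ (lv : ℕ)) R.div_num_pow.symm)).trans (pow_mul _ _ _).symm))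
  · exact (pull_comp S.tf.divisorMonoid (ModelFrobenioid.baseMap R.α) (ModelFrobenioid.baseMap Rl.α) _).trans
      (((congrArg (pull S.tf.divisorMonoid (ModelFrobenioid.baseMap R.α)) Rl.div_den_pow.symm).trans
        (map_pow _ _ _)).trans (((congrArg (· ^ (lv : ℕ)) R.div_den_pow.symm)).trans (pow_mul _ _ _).symm))

/-- **The stacked tower in `Φ^gp`** (`pullGp`): `[Div s^⊓_N]^{N·l} = Φ^gp((α_N ≫ α_l)^bs) [Div P.num]` and
`[Div s^⊔_N]^{N·l} = Φ^gp((α_N ≫ α_l)^bs) [Div P.den]` — the shape of the assembly's `hdesc` in model currency.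
[cite: MochizukiEtTh2009, Prop 5.2 (i) p.324 (PDF p.98)] -/
theorem hdesc_pullGp_tower :
    Algebra.GrothendieckGroup.of (ModelFrobenioid.div R.pair.num) ^ ((N : ℕ) * (lv : ℕ)) =
        pullGp S.tf.divisorMonoid (ModelFrobenioid.baseMap (R.α ≫ Rl.α))
          (Algebra.GrothendieckGroup.of (ModelFrobenioid.div P.num)) ∧
      Algebra.GrothendieckGroup.of (ModelFrobenioid.div R.pair.den) ^ ((N : ℕ) * (lv : ℕ)) =
        pullGp S.tf.divisorMonoid (ModelFrobenioid.baseMap (R.α ≫ Rl.α))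
          (Algebra.GrothendieckGroup.of (ModelFrobenioid.div P.den)) := by
  obtain ⟨hc, hp⟩ := pull_div_pair_eq_div_pow_tower (Rl := Rl) R
  exact ⟨((pullGp_of _ _).trans ((congrArg Algebra.GrothendieckGroup.of hc).trans (map_pow _ _ _))).symm,
    ((pullGp_of _ _).trans ((congrArg Algebra.GrothendieckGroup.of hp).trans (map_pow _ _ _))).symm⟩

end BiKummerSetting.NthRoot

end Literature.AnabelianGeometry.EtaleTheta
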